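import Mathlib
import Literature.GroupTheory.CombinatorialGroupTheory.SignedHurwitzAction
import Literature.GroupTheory.CombinatorialGroupTheory.SignedHurwitzStabilisation
import Literature.GroupTheory.CombinatorialGroupTheory.SignedHurwitzExchange
import HarnessLib

/-!
# Matsumoto's normal form for four-letter genus-one words, I: algebra of the `ℤ²` model

Helper file for stub D-alg (`stub_matsumotoNormalForm`) of line `folded-curve-branch-locus` of the
crux `ConvexBisection.AcyclicBisectionRigidity` (item stmt-SmoothPoincare4-10507).  Pure algebra over
the `SignedHurwitz` vocabulary: the genus-one lattice `H₁(F_{1,1}; ℤ) = ℤ²` (`Fin 1 ⊕ Fin 1 → ℤ`) with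
the standard symplectic pairing `ω = stdSymp ℤ 1`, `ω(x,y) = x₁ y₂ − x₂ y₁`, its signed transvections
`T_{(v,ε)} y = y + ε ω(v,y) v` (Picard–Lefschetz), primitive vectors, and the first facts on
four-letter words `[x₁, x₂, x₃, x₄]` with trivial signed monodromy `T₁ T₂ T₃ T₄ = 1`:

* `Matsumoto.eq_or_eq_neg_of_om_eq_zero` — primitive `x, y` with `ω(x,y) = 0` satisfy `y = ±x`;
* `Matsumoto.wordProduct_eq_of_hurwitzStep`, `Matsumoto.isPrimitive_of_hurwitzStep` — a signed
  Hurwitz move keeps the monodromy and the primitivity of the letters;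
* `Matsumoto.pair_eq_of_prod` (`T₁ T₂ = T₄⁻¹ T₃⁻¹`), `Matsumoto.prod_rotate` (cyclic invariance);
* `helper_fund_identity` — the expanded scalar identity `ω(x, T₁ T₂ y) = ω(x, T₄⁻¹ T₃⁻¹ y)`, whose
  specialisations at the classes of the word are the polynomial identities driving the descent of
  parts III–IV.

Reference: Y. Matsumoto, *Torus fibrations over the 2-sphere with the simplest singular fibers*,
J. Math. Soc. Japan 37 (1985) 605–636, §3 (Def. 3.1: the elementary transformations `R_j^{±1}` are
the two alternatives of `SignedHurwitz.HurwitzStep`; Thm. 3.2: the normal form).  Everything here is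
proved; no axioms beyond Lean's, no `sorry`.
-/

set_option linter.dupNamespace false

namespace Summit.SmoothPoincare4.SmoothPoincare4.Theorems.AcyclicBisectionRigidity.FoldedCurveBranchLocus

open Literature.GroupTheory.CombinatorialGroupTheory.SignedHurwitz

namespace Matsumoto

/-! ## The pairing in coordinates -/

/-- Closed formula `ω(x,y) = x₁ y₂ − x₂ y₁` in genus one. [folklore] -/
theorem om_apply (x y : Fin 1 ⊕ Fin 1 → ℤ) :
    (stdSymp ℤ 1) x y = x (Sum.inl 0) * y (Sum.inr 0) - x (Sum.inr 0) * y (Sum.inl 0) := by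
  rw [stdSymp_int_apply]
  simp

/-- The Plücker relation among the six pairings of four vectors of `ℤ²`. [folklore] -/
theorem om_pluecker (x y z w : Fin 1 ⊕ Fin 1 → ℤ) :
    (stdSymp ℤ 1) x y * (stdSymp ℤ 1) z w - (stdSymp ℤ 1) x z * (stdSymp ℤ 1) y w +
        (stdSymp ℤ 1) x w * (stdSymp ℤ 1) y z = 0 := by
  simp only [om_apply]; ring

/-- A vector of `ℤ²` is determined by its two coordinates. [folklore] -/
theorem vec_ext {x y : Fin 1 ⊕ Fin 1 → ℤ} (h₁ : x (Sum.inl 0) = y (Sum.inl 0))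
    (h₂ : x (Sum.inr 0) = y (Sum.inr 0)) : x = y := by
  funext i
  rcases i with i | i <;> fin_cases i <;> assumption

/-- Pairing against the second basis vector reads off the first coordinate. [folklore] -/
theorem om_single_inr (x : Fin 1 ⊕ Fin 1 → ℤ) : (stdSymp ℤ 1) x (Pi.single (Sum.inr 0) 1) =
    x (Sum.inl 0) := by
  rw [om_apply]; simp

/-- Pairing against the first basis vector reads off minus the second coordinate. [folklore] -/
theorem om_single_inl (x : Fin 1 ⊕ Fin 1 → ℤ) : (stdSymp ℤ 1) x (Pi.single (Sum.inl 0) 1) =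
    -x (Sum.inr 0) := by
  rw [om_apply]; simp

/-- A vector pairing to zero with everything is zero. [folklore] -/
theorem eq_zero_of_om_eq_zero {x : Fin 1 ⊕ Fin 1 → ℤ} (h : ∀ y, (stdSymp ℤ 1) x y = 0) : x = 0 := by
  apply vec_ext
  · simpa [om_single_inr] using h (Pi.single (Sum.inr 0) 1)
  · have := h (Pi.single (Sum.inl 0) 1)
    rw [om_single_inl] at this
    simpa using this

/-- A non-zero vector pairs non-trivially with some vector. [folklore] -/
theorem exists_om_ne_zero {x : Fin 1 ⊕ Fin 1 → ℤ} (hx : x ≠ 0) : ∃ y, (stdSymp ℤ 1) x y ≠ 0 := by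
  by_contra h
  exact hx (eq_zero_of_om_eq_zero fun y => by by_contra hy; exact h ⟨y, hy⟩)

/-! ## Primitive vectors -/

/-- The zero vector is not primitive. [folklore] -/
theorem not_isPrimitive_zero : ¬ IsPrimitive (0 : Fin 1 ⊕ Fin 1 → ℤ) := by
  intro h
  have h2 := h 2 (fun i => by simp)
  rcases Int.isUnit_iff.mp h2 with h' | h' <;> norm_num at h'

/-- A primitive vector is non-zero. [folklore] -/
theorem IsPrimitive.ne_zero' {x : Fin 1 ⊕ Fin 1 → ℤ} (hx : IsPrimitive x) : x ≠ 0 := by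
  rintro rfl; exact not_isPrimitive_zero hx

/-- The two coordinates of a primitive vector of `ℤ²` are coprime. [folklore] -/
theorem isCoprime_of_isPrimitive {x : Fin 1 ⊕ Fin 1 → ℤ} (hx : IsPrimitive x) :
    IsCoprime (x (Sum.inl 0)) (x (Sum.inr 0)) := by
  rw [Int.isCoprime_iff_gcd_eq_one]
  have h := hx (Int.gcd (x (Sum.inl 0)) (x (Sum.inr 0))) (by
    rintro (i | i) <;> fin_cases i
    · exact Int.gcd_dvd_left _ _
    · exact Int.gcd_dvd_right _ _)
  rcases Int.isUnit_iff.mp h with h' | h'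
  · exact_mod_cast h'
  · have : (0 : ℤ) ≤ (Int.gcd (x (Sum.inl 0)) (x (Sum.inr 0)) : ℤ) := by positivity
    omega

/-- Two primitive vectors with vanishing pairing are equal up to sign. [folklore] -/
theorem eq_or_eq_neg_of_om_eq_zero {x y : Fin 1 ⊕ Fin 1 →
    ℤ} (hx : IsPrimitive x) (hy : IsPrimitive y)
    (h : (stdSymp ℤ 1) x y = 0) : y = x ∨ y = -x := by
  rw [om_apply] at h
  obtain ⟨p, q, hpq⟩ := isCoprime_of_isPrimitive hx
  set lam := p * y (Sum.inl 0) + q * y (Sum.inr 0) with hlam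
  have h1 : y (Sum.inl 0) = lam * x (Sum.inl 0) := by
    rw [hlam]; linear_combination (-y (Sum.inl 0)) * hpq + (-q) * h
  have h2 : y (Sum.inr 0) = lam * x (Sum.inr 0) := by
    rw [hlam]; linear_combination (-y (Sum.inr 0)) * hpq + p * h
  have hy' : y = lam • x := vec_ext (by simpa using h1) (by simpa using h2)
  have hu : IsUnit lam := hy lam (by
    rintro (i | i) <;> fin_cases i
    · exact ⟨_, by simpa [mul_comm] using h1⟩
    · exact ⟨_, by simpa [mul_comm] using h2⟩)
  rcases Int.isUnit_iff.mp hu with h' | h'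
  · left; rw [hy', h', one_smul]
  · right; rw [hy', h', neg_one_smul]

/-! ## Signed transvections in genus one -/

/-- `sgn b = ±1`. [folklore] -/
theorem sgn_eq_or (b : Bool) : (sgn b : ℤ) = 1 ∨ (sgn b : ℤ) = -1 := by
  cases b <;> simp

/-- `sgn b * sgn b = 1`. [folklore] -/
theorem sgn_mul_self (b : Bool) : (sgn b : ℤ) * sgn b = 1 := by
  cases b <;> simp

/-- The transvection of a letter does not see the sign of its vector: `T_{(−v,ε)} = T_{(v,ε)}`. [folklore] -/
theorem transvection_neg_fst (v : Fin 1 ⊕ Fin 1 → ℤ) (s : Bool) :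
    transvection (stdSymp ℤ 1) (-v, s) = transvection (stdSymp ℤ 1) (v, s) := by
  apply LinearMap.ext
  intro y
  simp only [transvection_apply, map_neg, LinearMap.neg_apply, mul_neg, neg_smul, smul_neg, neg_neg]

/-- A transvection fixes its own vector. [folklore] -/
theorem transvection_apply_self (v : Fin 1 ⊕ Fin 1 →
    ℤ) (s : Bool) : transvection (stdSymp ℤ 1) (v, s) v = v := by
  simp [transvection_apply, stdSymp_int_self]

/-- `T_{(v,ε)} T_{(v,¬ε)} = 1` (adapted from `HurwitzOrbitDecomposable.transvection_mul_transvection_not`).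
[folklore] -/
theorem tv_mul_tv_not (v : Fin 1 ⊕ Fin 1 → ℤ) (s : Bool) :
    transvection (stdSymp ℤ 1) (v, s) * transvection (stdSymp ℤ 1) (v, !s) = 1 := by
  have hsn : ∀ b : Bool, (sgn (!b) : ℤ) = -sgn b := fun b => by cases b <;> simp
  apply LinearMap.ext
  intro y
  simp only [Module.End.mul_apply, transvection_apply, map_add, map_smul, stdSymp_int_self,
    mul_zero, zero_smul, add_zero, Module.End.one_apply, hsn]
  module

/-- `T_{(v,¬ε)} T_{(v,ε)} = 1`. [folklore] -/
theorem tv_not_mul_tv (v : Fin 1 ⊕ Fin 1 → ℤ) (s : Bool) :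
    transvection (stdSymp ℤ 1) (v, !s) * transvection (stdSymp ℤ 1) (v, s) = 1 := by
  have := tv_mul_tv_not v (!s)
  simpa using this

/-- Transvections preserve primitivity (the inverse transvection is integral). [folklore] -/
theorem isPrimitive_transvection {v : Fin 1 ⊕ Fin 1 → ℤ} (x : (Fin 1 ⊕ Fin 1 → ℤ) × Bool)
    (hv : IsPrimitive v) : IsPrimitive (transvection (stdSymp ℤ 1) x v) := by
  intro d hd
  apply hv d
  intro i
  have hback : transvection (stdSymp ℤ 1) (x.1, !x.2) (transvection (stdSymp ℤ 1) x v) = v := by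
    have := LinearMap.congr_fun (tv_not_mul_tv x.1 x.2) v
    simpa using this
  rw [← hback, transvection_apply]
  simp only [Pi.add_apply, Pi.smul_apply, smul_eq_mul]
  refine dvd_add (hd i) (dvd_mul_of_dvd_left (dvd_mul_of_dvd_right ?_ _) _)
  rw [om_apply]
  exact dvd_sub (dvd_mul_of_dvd_right (hd _) _) (dvd_mul_of_dvd_right (hd _) _)


/-! ## Hurwitz moves preserve the signed monodromy (genus one) -/

/-- First Hurwitz identity `T_{T_a b} (T_a y) = T_a (T_b y)` (adapted from
`ModpBraidOrbits.ReachInvariants.transvection_hurwitz₁`). [folklore] -/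
theorem transvection_hurwitz₁ (a : Fin 1 ⊕ Fin 1 → ℤ) (sa : Bool) (b : Fin 1 ⊕ Fin 1 →
    ℤ) (sb : Bool)
    (y : Fin 1 ⊕ Fin 1 → ℤ) :
    transvection (stdSymp ℤ 1) (b +
        (sgn sa * (stdSymp ℤ 1) a b) • a, sb) (transvection (stdSymp ℤ 1) (a, sa) y) =
      transvection (stdSymp ℤ 1) (a, sa) (transvection (stdSymp ℤ 1) (b, sb) y) := by
  have hs : (stdSymp ℤ 1) b a = -(stdSymp ℤ 1) a b := stdSymp_int_swap 1 b a
  simp only [transvection_apply, map_add, map_smul, LinearMap.add_apply, LinearMap.smul_apply,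
    smul_eq_mul, stdSymp_int_self, hs]
  module

/-- Second Hurwitz identity `T_b (T_{T_b⁻¹ a} y) = T_a (T_b y)` (adapted from
`ModpBraidOrbits.ReachInvariants.transvection_hurwitz₂`). [folklore] -/
theorem transvection_hurwitz₂ (a : Fin 1 ⊕ Fin 1 → ℤ) (sa : Bool) (b : Fin 1 ⊕ Fin 1 →
    ℤ) (sb : Bool)
    (y : Fin 1 ⊕ Fin 1 → ℤ) :
    transvection (stdSymp ℤ 1) (b, sb) (transvection (stdSymp ℤ 1) (a -
        (sgn sb * (stdSymp ℤ 1) b a) • b, sa) y) =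
      transvection (stdSymp ℤ 1) (a, sa) (transvection (stdSymp ℤ 1) (b, sb) y) := by
  have hs : (stdSymp ℤ 1) b a = -(stdSymp ℤ 1) a b := stdSymp_int_swap 1 b a
  simp only [transvection_apply, map_add, map_smul, map_sub, LinearMap.smul_apply,
    LinearMap.sub_apply, smul_eq_mul, stdSymp_int_self, hs]
  module

/-- A signed Hurwitz move does not change the signed monodromy (adapted from
`ModpBraidOrbits.ReachInvariants.wordProduct_eq_of_hurwitzStep`). [folklore] -/
theorem wordProduct_eq_of_hurwitzStep {l l' : IntWord 1} (h : HurwitzStep (stdSymp ℤ 1) l l') :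
    wordProduct (stdSymp ℤ 1) l' = wordProduct (stdSymp ℤ 1) l := by
  obtain ⟨pre, suf, ⟨a, sa⟩, ⟨b, sb⟩, rfl, rfl | rfl⟩ := h
  · refine LinearMap.ext fun y => ?_
    simp only [wordProduct_append, wordProduct_cons, Module.End.mul_apply, transvection_hurwitz₁]
  · refine LinearMap.ext fun y => ?_
    simp only [wordProduct_append, wordProduct_cons, Module.End.mul_apply, transvection_hurwitz₂]

/-- A signed Hurwitz move keeps all letters primitive. [folklore] -/
theorem isPrimitive_of_hurwitzStep {l l' : IntWord 1} (h : HurwitzStep (stdSymp ℤ 1) l l')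
    (hl : ∀ x ∈ l, IsPrimitive x.1) : ∀ x ∈ l', IsPrimitive x.1 := by
  have hsn : ∀ b : Bool, (sgn (!b) : ℤ) = -sgn b := fun b => by cases b <;> simp
  obtain ⟨pre, suf, a, b, rfl, rfl | rfl⟩ := h
  · intro x hx
    simp only [List.mem_append, List.mem_cons] at hx
    rcases hx with hx | rfl | rfl | hx
    · exact hl x (by simp [hx])
    · have := isPrimitive_transvection a (hl b (by simp))
      simpa [transvection_apply] using this
    · exact hl _ (by simp)
    · exact hl x (by simp [hx])
  · intro x hx
    simp only [List.mem_append, List.mem_cons] at hx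
    rcases hx with hx | rfl | rfl | hx
    · exact hl x (by simp [hx])
    · exact hl _ (by simp)
    · have := isPrimitive_transvection (b.1, !b.2) (hl a (by simp))
      simpa [transvection_apply, hsn, sub_eq_add_neg] using this
    · exact hl x (by simp [hx])

/-! ## Four-letter words with trivial monodromy -/

/-- The monodromy of a four-letter word. [folklore] -/
theorem wordProduct_four (x₁ x₂ x₃ x₄ : (Fin 1 ⊕ Fin 1 → ℤ) × Bool) :
    wordProduct (stdSymp ℤ 1) [x₁, x₂, x₃, x₄] =
      transvection (stdSymp ℤ 1) x₁ * (transvection (stdSymp ℤ 1) x₂ *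
          (transvection (stdSymp ℤ 1) x₃ * transvection (stdSymp ℤ 1) x₄)) := by
  simp [wordProduct_cons]

/-- `T₁ T₂ T₃ T₄ = 1` gives `T₁ T₂ = T₄⁻¹ T₃⁻¹`. [folklore] -/
theorem pair_eq_of_prod {x₁ x₂ x₃ x₄ : (Fin 1 ⊕ Fin 1 → ℤ) × Bool}
    (h : wordProduct (stdSymp ℤ 1) [x₁, x₂, x₃, x₄] = 1) :
    transvection (stdSymp ℤ 1) x₁ * transvection (stdSymp ℤ 1) x₂ =
      transvection (stdSymp ℤ 1) (x₄.1, !x₄.2) * transvection (stdSymp ℤ 1) (x₃.1, !x₃.2) := by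
  rw [wordProduct_four] at h
  have h4 := tv_mul_tv_not x₄.1 x₄.2
  have h3 := tv_mul_tv_not x₃.1 x₃.2
  calc transvection (stdSymp ℤ 1) x₁ * transvection (stdSymp ℤ 1) x₂
      = transvection (stdSymp ℤ 1) x₁ * transvection (stdSymp ℤ 1) x₂ *
          (transvection (stdSymp ℤ 1) x₃ * (transvection (stdSymp ℤ 1) x₄ *
              transvection (stdSymp ℤ 1) (x₄.1, !x₄.2)) *
            transvection (stdSymp ℤ 1) (x₃.1, !x₃.2)) := by rw [h4, mul_one, h3, mul_one]
    _ = transvection (stdSymp ℤ 1) x₁ * (transvection (stdSymp ℤ 1) x₂ *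
        (transvection (stdSymp ℤ 1) x₃ * transvection (stdSymp ℤ 1) x₄)) *
          (transvection (stdSymp ℤ 1) (x₄.1, !x₄.2) * transvection (stdSymp ℤ 1) (x₃.1, !x₃.2)) :=
              by
        simp only [mul_assoc]
    _ = transvection (stdSymp ℤ 1) (x₄.1, !x₄.2) * transvection (stdSymp ℤ 1) (x₃.1, !x₃.2) :=
        by rw [h, one_mul]

/-- Trivial monodromy is invariant under cyclic rotation of the word. [folklore] -/
theorem prod_rotate {x₁ x₂ x₃ x₄ : (Fin 1 ⊕ Fin 1 → ℤ) × Bool}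
    (h : wordProduct (stdSymp ℤ 1) [x₁, x₂, x₃, x₄] =
        1) : wordProduct (stdSymp ℤ 1) [x₂, x₃, x₄, x₁] = 1 := by
  rw [wordProduct_four] at h ⊢
  have h1 := tv_not_mul_tv x₁.1 x₁.2
  set P := transvection (stdSymp ℤ 1) x₂ * (transvection (stdSymp ℤ 1) x₃ *
      transvection (stdSymp ℤ 1) x₄)
  calc transvection (stdSymp ℤ 1) x₂ * (transvection (stdSymp ℤ 1) x₃ *
      (transvection (stdSymp ℤ 1) x₄ * transvection (stdSymp ℤ 1) x₁))
      = P * transvection (stdSymp ℤ 1) x₁ := by simp only [P, mul_assoc]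
    _ = transvection (stdSymp ℤ 1) (x₁.1, !x₁.2) * (transvection (stdSymp ℤ 1) x₁ * P) *
        transvection (stdSymp ℤ 1) x₁ := by
        rw [← mul_assoc (transvection (stdSymp ℤ 1) (x₁.1, !x₁.2)), h1, one_mul]
    _ = 1 := by rw [h, mul_one, h1]

end Matsumoto

/-- **The fundamental identity.**  For a four-letter word with trivial monodromy,
`ω(x, T₁ T₂ y) = ω(x, T₄⁻¹ T₃⁻¹ y)`, expanded. [folklore] -/
theorem helper_fund_identity {v₁ v₂ v₃ v₄ : Fin 1 ⊕ Fin 1 → ℤ} {b₁ b₂ b₃ b₄ : Bool}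
    (h : wordProduct (stdSymp ℤ 1) [(v₁, b₁), (v₂, b₂), (v₃, b₃), (v₄, b₄)] =
        1) (x y : Fin 1 ⊕ Fin 1 → ℤ) :
    (stdSymp ℤ 1) x y + sgn b₂ * (stdSymp ℤ 1) v₂ y * (stdSymp ℤ 1) x v₂ +
        sgn b₁ * ((stdSymp ℤ 1) v₁ y +
        sgn b₂ * (stdSymp ℤ 1) v₂ y * (stdSymp ℤ 1) v₁ v₂) * (stdSymp ℤ 1) x v₁ =
      (stdSymp ℤ 1) x y - sgn b₃ * (stdSymp ℤ 1) v₃ y * (stdSymp ℤ 1) x v₃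
        - sgn b₄ * ((stdSymp ℤ 1) v₄ y +
            sgn b₃ * (stdSymp ℤ 1) v₃ y * (stdSymp ℤ 1) v₃ v₄) * (stdSymp ℤ 1) x v₄ := by
  have hsn : ∀ b : Bool, (sgn (!b) : ℤ) = -sgn b := fun b => by cases b <;> simp
  have := LinearMap.congr_fun (Matsumoto.pair_eq_of_prod h) y
  simp only [Module.End.mul_apply] at this
  have hx := congrArg ((stdSymp ℤ 1) x) this
  simp only [transvection_apply, map_add, map_smul, smul_eq_mul, hsn,
    stdSymp_int_swap 1 v₄ v₃] at hx
  linear_combination hx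

end Summit.SmoothPoincare4.SmoothPoincare4.Theorems.AcyclicBisectionRigidity.FoldedCurveBranchLocus
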